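import Summits.QuantumFields.BalabanUV.Beta.GAN24.DerivativeRateTransferJensenMeanZeroEnd

/-!
# `BalabanUV.Beta.GAN24.DerivativeRateTransferJensenMeanZeroPolar` — binder row G-an2-4 ∕ (CONV-C), route R6 «VALUES, NOT DERIVATIVES», PART 51:
# THE POLAR (WILSON) DICTIONARY — for ANY colour dimension and without logarithms: if the block mean of the root-frame loop transports is SYMMETRIC
# (the coarse link chosen as the orthogonal POLAR FACTOR of the mean of the open transports — the «Wilson average» (1.26) of Bałaban–Jaffe, Erice 1985),
# then `0 ≤ ⟨w,(Σ_x q_xN_x)w⟩ ≤ (κ²∕2)|w|²` and `κ₂ ≤ κ²∕2` — the pair is CONSISTENT with `c = 1∕2` (unit b2b-balaban-gan24-p3, gen 42; v1;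
# the mechanism is gan24-idea-1 g55's located supply L-idea1-g55-1, l.47140 — credited, typed here)

NOT IN PRINT; OUR PROOF (for the ROUTE; [folklore] finite-dimensional linear algebra over `ℝ`: the polarisation identity `⟨w,(1 − V)w⟩ = |(1 − V)w|²∕2` for
orthogonal `V`, Cauchy–Schwarz for a symmetric positive-semidefinite matrix form, PART 48's `covJensen_consistent` BY NAME).  HONEST FRAMING (cell contract,
verbatim): «discharging `BetaPertH` makes Bałaban's UV stability UNCONDITIONAL — a real constructive-QFT result; it is NOT the continuum limit and NOT the
Clay problem.»  HONEST DEPENDENCY (verbatim): «continuum YM on T⁴ ⇐ BetaPertH ∧ nine spine estimates (0/9 proved); BetaPertH ⇐ (D1) ∧ (D4) ∧ CAP+tail;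
G-an2-4 gates asym, D1 and NE2/3/4.»

WHY THIS FILE.  PART 48 §2–§3 make Bałaban's LOGARITHMIC average ([CMP 98] (42); Erice (1.28)) a consistent pair in the ABELIAN model (mean-zero loop angles
⟹ `κ₂ ≤ κ²`).  Bałaban–Jaffe [Erice 1985, printed p. 221, (1.26)–(1.28)] list three block averages of the contour variables — (1.26) the «Wilson average»
`Ū = Proj(L^{−d}Σ_x U(Γ_{yy′,x}))` (`Proj` = unitary polar factor), (1.27) Federbush's Riemannian centre of mass, (1.28) the exp-mean-log — «certain technical
results were established using (1.28), but these proofs also extend to the other two».  For (1.26) consistency is AUTOMATIC and needs neither commutativity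
nor logarithms: «`R′` = polar factor of the mean `M` of the open transports» says exactly that the mean of the root-frame loop transports `Σ_x q_xV̂_x = MR′ᵀ` is
SYMMETRIC positive, and a mean of orthogonal matrices that is symmetric is a mean of cosines.  THIS FILE types the algebra: (§1) for orthogonal `V`,
`⟨w,(1 − V)w⟩ = |(1 − V)w|²∕2` (`form_one_sub_eq_half`), hence `0 ≤ ⟨w,(Σ_x q_x(1 − V_x))w⟩ ≤ (κ²∕2)|w|²` for weights `q ≥ 0`, `Σq ≤ 1` and pointwise defects
`≤ κ` (`wsum_defect_form_bounds`) — NO symmetry needed for the quadratic form; (§2) Cauchy–Schwarz for a symmetric PSD matrix form (`form_cauchySchwarz`) and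
«`Sᵀ = S`, `0 ≤ ⟨w,Sw⟩ ≤ s|w|²` ⟹ `|Sc|² ≤ s²|c|²» (`sq_mulVec_le_of_form_le`); (§3) THE POLAR DICTIONARY `wsum_defect_le_of_symm`: orthogonal `V_x`,
`|(1 − V_x)w|² ≤ κ²|w|²`, `Σ_x q_x(1 − V_x)` SYMMETRIC ⟹ `|(Σ_x q_x(1 − V_x))c|² ≤ (κ²∕2)²|c|²` — PART 47's `hM` with `κ₂ = κ²∕2`; (§4) THE POLAR END
`covJensen_polar`: PART 47's letters + `R′` orthogonal + the symmetry of the mean root-frame defect ⟹ `⟨Qu,H_cQu⟩ ≤ (1 + (1 + 2ϖ(1+κ))κ)⟨u,H_fu⟩ + (1+κ)κ³∕2·w_c d′⟨Qu,Qu⟩`.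

WHAT THIS FILE PROVES (0 sorry, 0 `def`, nothing cited): §1 `form_one_sub_eq_half`, `wsum_defect_form_bounds`; §2 `dotProduct_mulVec_symm`, `form_cauchySchwarz`,
`sq_mulVec_le_of_form_le`; §3 **`wsum_defect_le_of_symm`**, `wsum_defect_symm_of_polar` (`Σ_x q_xO_x = P·R′`, `Pᵀ = P`, `R′` orthogonal ⟹ the letter `hsym`); §4 **`covJensen_polar`**.
WHAT IT DOES NOT DO: prove that the polar factor EXISTS ∕ is the printed `Proj` for `SU(N)` (Erice's modified polar decomposition `X = U·e^{iθ}·H` has a phase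
`θ = O(κ³)` — not typed), treat (1.27) ∕ the non-abelian (1.28) (BCH), instantiate anything of Bałaban's, or claim (CONS) ∕ exact (STAB).  SUPPLIER work on
route R6 (rank 2, REDUCTION, no seat); no consumer of record; NEVER «G-an2-4 closed»; NOT (CONV-C), NOT D1, NOT `BetaPertH`, NOT continuum, NOT Clay.
Records: `HOME/b2b-balaban-gan24-p3/WOODBURY-FIBRE.md` v14.2. -/

noncomputable section

open Matrix Finset

namespace Summit.QuantumFields.BalabanUV.Beta.GAN24.DerivativeRateTransferJensenMeanZeroPolar

open Summit.QuantumFields.BalabanUV.Beta.GAN24.DerivativeRateTransferLoewnerKKT (mulVec_dotProduct_eq)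
open Summit.QuantumFields.BalabanUV.Beta.GAN24.DerivativeRateTransferJensenChain
open Summit.QuantumFields.BalabanUV.Beta.GAN24.DerivativeRateTransferJensen
open Summit.QuantumFields.BalabanUV.Beta.GAN24.DerivativeRateTransferJensenMeanZero
open Summit.QuantumFields.BalabanUV.Beta.GAN24.DerivativeRateTransferJensenMeanZeroEnd

/-! ## §1 The polarisation identity and the quadratic-form bounds of the mean defect -/

section Form

variable {o : Type*} [Fintype o] [DecidableEq o]

/-- **`⟨w,(1 − V)w⟩ = |(1 − V)w|²∕2`** for orthogonal `V` (polarisation: `|(1 − V)w|² = 2|w|² − 2⟨w,Vw⟩`). [folklore] -/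
theorem form_one_sub_eq_half {V : Matrix o o ℝ} (hV : Vᵀ * V = 1) (w : o → ℝ) :
    w ⬝ᵥ ((1 - V) *ᵥ w) = ((1 - V) *ᵥ w) ⬝ᵥ ((1 - V) *ᵥ w) / 2 := by
  have h1 : (V *ᵥ w) ⬝ᵥ (V *ᵥ w) = w ⬝ᵥ w := self_of_orthogonal hV w
  simp only [sub_mulVec, one_mulVec, dotProduct_sub, sub_dotProduct]
  rw [dotProduct_comm (V *ᵥ w) w, h1]
  ring

/-- **THE MEAN DEFECT AS A QUADRATIC FORM**: weights `q ≥ 0` with `Σq ≤ 1`, orthogonal `V_x` with `|(1 − V_x)w|² ≤ κ²|w|²` ⟹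
`0 ≤ ⟨w,(Σ_x q_x(1 − V_x))w⟩ ≤ (κ²∕2)·|w|²` — no symmetry, no commutativity. [our proof] -/
theorem wsum_defect_form_bounds {ν : Type*} (s : Finset ν) {q : ν → ℝ} (hq : ∀ x ∈ s, 0 ≤ q x) (hq1 : ∑ x ∈ s, q x ≤ 1)
    {V : ν → Matrix o o ℝ} (hV : ∀ x ∈ s, (V x)ᵀ * V x = 1) {κ : ℝ}
    (hκ : ∀ x ∈ s, ∀ w : o → ℝ, (((1 - V x) *ᵥ w) ⬝ᵥ ((1 - V x) *ᵥ w)) ≤ κ ^ 2 * (w ⬝ᵥ w)) (w : o → ℝ) :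
    0 ≤ w ⬝ᵥ ((∑ x ∈ s, q x • (1 - V x)) *ᵥ w) ∧ w ⬝ᵥ ((∑ x ∈ s, q x • (1 - V x)) *ᵥ w) ≤ κ ^ 2 / 2 * (w ⬝ᵥ w) := by
  have e : w ⬝ᵥ ((∑ x ∈ s, q x • (1 - V x)) *ᵥ w) = ∑ x ∈ s, q x * ((((1 - V x) *ᵥ w) ⬝ᵥ ((1 - V x) *ᵥ w)) / 2) := by
    rw [Matrix.sum_mulVec, dotProduct_sum]
    refine Finset.sum_congr rfl fun x hx => ?_
    rw [smul_mulVec, dotProduct_smul, smul_eq_mul, form_one_sub_eq_half (hV x hx)]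
  rw [e]
  refine ⟨Finset.sum_nonneg fun x hx => mul_nonneg (hq x hx) (div_nonneg (dotProduct_self_nonneg' _) two_pos.le), ?_⟩
  have hw0 : 0 ≤ w ⬝ᵥ w := dotProduct_self_nonneg' _
  calc ∑ x ∈ s, q x * ((((1 - V x) *ᵥ w) ⬝ᵥ ((1 - V x) *ᵥ w)) / 2)
      ≤ ∑ x ∈ s, q x * (κ ^ 2 * (w ⬝ᵥ w) / 2) := Finset.sum_le_sum fun x hx =>
          mul_le_mul_of_nonneg_left (div_le_div_of_nonneg_right (hκ x hx w) two_pos.le) (hq x hx)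
    _ = (∑ x ∈ s, q x) * (κ ^ 2 * (w ⬝ᵥ w) / 2) := by rw [Finset.sum_mul]
    _ ≤ 1 * (κ ^ 2 * (w ⬝ᵥ w) / 2) := mul_le_mul_of_nonneg_right hq1 (by positivity)
    _ = κ ^ 2 / 2 * (w ⬝ᵥ w) := by ring

end Form

/-! ## §2 Cauchy–Schwarz for a symmetric positive-semidefinite matrix form; quadratic-form bounds ⟹ the operator bound -/

section CauchySchwarz

variable {o : Type*} [Fintype o]

/-- `Sᵀ = S ⟹ ⟨u, Sv⟩ = ⟨v, Su⟩`. [folklore] -/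
theorem dotProduct_mulVec_symm {S : Matrix o o ℝ} (hS : Sᵀ = S) (u v : o → ℝ) : u ⬝ᵥ (S *ᵥ v) = v ⬝ᵥ (S *ᵥ u) := by
  rw [dotProduct_comm u, mulVec_dotProduct_eq, hS]

/-- **CAUCHY–SCHWARZ FOR A SYMMETRIC PSD MATRIX FORM**: `Sᵀ = S`, `⟨w,Sw⟩ ≥ 0 ∀w` ⟹ `⟨u,Sv⟩² ≤ ⟨u,Su⟩·⟨v,Sv⟩`. [folklore] -/
theorem form_cauchySchwarz {S : Matrix o o ℝ} (hS : Sᵀ = S) (hpsd : ∀ w : o → ℝ, 0 ≤ w ⬝ᵥ (S *ᵥ w)) (u v : o → ℝ) :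
    (u ⬝ᵥ (S *ᵥ v)) ^ 2 ≤ (u ⬝ᵥ (S *ᵥ u)) * (v ⬝ᵥ (S *ᵥ v)) := by
  set a := u ⬝ᵥ (S *ᵥ u) with ha
  set b := u ⬝ᵥ (S *ᵥ v) with hb
  set c := v ⬝ᵥ (S *ᵥ v) with hc
  have hba : v ⬝ᵥ (S *ᵥ u) = b := (dotProduct_mulVec_symm hS u v).symm
  have ha0 : 0 ≤ a := hpsd u
  have hc0 : 0 ≤ c := hpsd v
  -- the form on a combination `α•u + β•v`
  have expand : ∀ α β : ℝ, (α • u + β • v) ⬝ᵥ (S *ᵥ (α • u + β • v)) = α ^ 2 * a + 2 * α * β * b + β ^ 2 * c := by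
    intro α β
    simp only [mulVec_add, mulVec_smul, dotProduct_add, add_dotProduct, dotProduct_smul, smul_dotProduct, smul_eq_mul]
    rw [hba, ← ha, ← hb, ← hc]; ring
  rcases lt_or_ge 0 c with hcpos | hcle
  · -- `c > 0`: test vector `c•u − b•v`
    have h := hpsd (c • u + (-b) • v)
    rw [expand] at h
    have h' : 0 ≤ c * (a * c - b ^ 2) := by nlinarith [h]
    have h'' : 0 ≤ a * c - b ^ 2 := by
      by_contra hneg; rw [not_le] at hneg; nlinarith [mul_neg_of_pos_of_neg hcpos hneg]
    nlinarith [h'']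
  · -- `c = 0`: then `b = 0`
    have hc' : c = 0 := le_antisymm hcle hc0
    have hb0 : b = 0 := by
      by_contra hne
      have h := hpsd ((1 : ℝ) • u + (-(a + 1) / (2 * b)) • v)
      rw [expand, hc'] at h
      have : (1 : ℝ) ^ 2 * a + 2 * 1 * (-(a + 1) / (2 * b)) * b + (-(a + 1) / (2 * b)) ^ 2 * 0 = -1 := by
        field_simp; ring
      linarith [this ▸ h]
    rw [hb0, hc']; nlinarith [ha0]

/-- **QUADRATIC-FORM BOUNDS ⟹ THE OPERATOR BOUND for a symmetric matrix**: `Sᵀ = S`, `0 ≤ ⟨w,Sw⟩ ≤ s|w|² ∀w` ⟹ `|Sc|² ≤ s²|c|²`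
(`|Sc|² = ⟨c,S(Sc)⟩ ≤ √(⟨c,Sc⟩⟨Sc,S Sc⟩)` by Cauchy–Schwarz). [folklore] -/
theorem sq_mulVec_le_of_form_le {S : Matrix o o ℝ} (hS : Sᵀ = S) {s : ℝ} (hpsd : ∀ w : o → ℝ, 0 ≤ w ⬝ᵥ (S *ᵥ w))
    (hle : ∀ w : o → ℝ, w ⬝ᵥ (S *ᵥ w) ≤ s * (w ⬝ᵥ w)) (c : o → ℝ) :
    (S *ᵥ c) ⬝ᵥ (S *ᵥ c) ≤ s ^ 2 * (c ⬝ᵥ c) := by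
  have hs0 : ∀ w : o → ℝ, w ⬝ᵥ w ≠ 0 → 0 ≤ s := fun w hw => by
    have h1 := (hpsd w).trans (hle w)
    have hw0 : 0 < w ⬝ᵥ w := lt_of_le_of_ne (dotProduct_self_nonneg' _) (Ne.symm hw)
    nlinarith
  have key : ((S *ᵥ c) ⬝ᵥ (S *ᵥ c)) ^ 2 ≤ (s * (c ⬝ᵥ c)) * (s * ((S *ᵥ c) ⬝ᵥ (S *ᵥ c))) := by
    have hcs := form_cauchySchwarz hS hpsd c (S *ᵥ c)
    have e : c ⬝ᵥ (S *ᵥ (S *ᵥ c)) = (S *ᵥ c) ⬝ᵥ (S *ᵥ c) := by rw [dotProduct_mulVec_symm hS c (S *ᵥ c)]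
    rw [e] at hcs
    refine hcs.trans ?_
    exact mul_le_mul (hle c) (hle (S *ᵥ c)) (hpsd _) ((hpsd c).trans (hle c))
  have hX0 : 0 ≤ (S *ᵥ c) ⬝ᵥ (S *ᵥ c) := dotProduct_self_nonneg' _
  rcases eq_or_lt_of_le hX0 with hX | hX
  · rw [← hX]
    rcases eq_or_lt_of_le (dotProduct_self_nonneg' c) with hc0 | hc0
    · rw [← hc0]; simp
    · exact mul_nonneg (sq_nonneg _) hc0.le
  · -- divide `X² ≤ (s|c|²)(sX)` by `X > 0`
    nlinarith [key, hX]

end CauchySchwarz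

/-! ## §3 THE POLAR DICTIONARY: symmetric mean transport ⟹ `κ₂ ≤ κ²∕2` -/

section Polar

variable {o : Type*} [Fintype o] [DecidableEq o]

/-- **`wsum_defect_le_of_symm` — THE POLAR (WILSON) DICTIONARY** [our proof; mechanism = gan24-idea-1 g55's L-idea1-g55-1]: weights `q ≥ 0` with `Σq ≤ 1`,
orthogonal `V_x` with pointwise defects `|(1 − V_x)w|² ≤ κ²|w|²`, and the block mean of the defects `Σ_x q_x(1 − V_x)` SYMMETRIC (equivalently: the mean
transport `Σ_x q_xV_x` symmetric — the coarse link chosen as the orthogonal polar factor of the mean of the open transports) ⟹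
`|(Σ_x q_x(1 − V_x))c|² ≤ (κ²∕2)²·|c|²`, i.e. PART 47's `hM` with `κ₂ = κ²∕2`, for ANY colour dimension, no logarithms, no commutativity. -/
theorem wsum_defect_le_of_symm {ν : Type*} (s : Finset ν) {q : ν → ℝ} (hq : ∀ x ∈ s, 0 ≤ q x) (hq1 : ∑ x ∈ s, q x ≤ 1)
    {V : ν → Matrix o o ℝ} (hV : ∀ x ∈ s, (V x)ᵀ * V x = 1) {κ : ℝ}
    (hκ : ∀ x ∈ s, ∀ w : o → ℝ, (((1 - V x) *ᵥ w) ⬝ᵥ ((1 - V x) *ᵥ w)) ≤ κ ^ 2 * (w ⬝ᵥ w))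
    (hsym : (∑ x ∈ s, q x • (1 - V x))ᵀ = ∑ x ∈ s, q x • (1 - V x)) (c : o → ℝ) :
    ((∑ x ∈ s, q x • (1 - V x)) *ᵥ c) ⬝ᵥ ((∑ x ∈ s, q x • (1 - V x)) *ᵥ c) ≤ (κ ^ 2 / 2) ^ 2 * (c ⬝ᵥ c) :=
  sq_mulVec_le_of_form_le hsym (fun w => (wsum_defect_form_bounds s hq hq1 hV hκ w).1)
    (fun w => (wsum_defect_form_bounds s hq hq1 hV hκ w).2) c

/-- **THE POLAR FACTOR MAKES THE MEAN DEFECT SYMMETRIC**: if the block mean of the open transports factors as `Σ_x q_x·O_x = P·R′` with `P` symmetric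
(`R′` = the orthogonal polar factor — the «Wilson average» (1.26)) then, with the loop transports `V_x = O_x·R′ᵀ`, the mean defect `Σ_x q_x(1 − O_xR′ᵀ)` is
SYMMETRIC — the letter `hsym` of `wsum_defect_le_of_symm` ∕ `covJensen_polar`. [folklore] -/
theorem wsum_defect_symm_of_polar {ν : Type*} (s : Finset ν) (q : ν → ℝ) {O : ν → Matrix o o ℝ} {P R' : Matrix o o ℝ}
    (hpolar : ∑ x ∈ s, q x • O x = P * R') (hP : Pᵀ = P) (hR' : R'ᵀ * R' = 1) :
    (∑ x ∈ s, q x • (1 - O x * R'ᵀ))ᵀ = ∑ x ∈ s, q x • (1 - O x * R'ᵀ) := by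
  have e : ∑ x ∈ s, q x • (1 - O x * R'ᵀ) = (∑ x ∈ s, q x) • (1 : Matrix o o ℝ) - P := by
    simp only [smul_sub, Finset.sum_sub_distrib, Finset.sum_smul]
    congr 1
    calc ∑ x ∈ s, q x • (O x * R'ᵀ) = ∑ x ∈ s, (q x • O x) * R'ᵀ := Finset.sum_congr rfl fun x _ => (smul_mul_assoc _ _ _).symm
      _ = (∑ x ∈ s, q x • O x) * R'ᵀ := (Finset.sum_mul s (fun x => q x • O x) R'ᵀ).symm
      _ = P := by rw [hpolar, Matrix.mul_assoc, mul_transpose_of_orthogonal hR', Matrix.mul_one]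
  rw [e, transpose_sub, transpose_smul, transpose_one, hP]

end Polar

/-! ## §4 THE POLAR END -/

section End

variable {o μ ν β β' : Type*} [Fintype o] [DecidableEq o] [Fintype μ] [DecidableEq μ] [Fintype ν] [Fintype β] [DecidableEq β] [Fintype β']
variable {q : μ → ν → ℝ} {W : μ → ν → Matrix o o ℝ} {Q : Matrix (μ × o) (ν × o) ℝ}
variable {src tgt : β → ν} {R : β → Matrix o o ℝ} {src' tgt' : β' → μ} {R' : β' → Matrix o o ℝ}
variable {Hf : Matrix (ν × o) (ν × o) ℝ} {Hc : Matrix (μ × o) (μ × o) ℝ} {wf wc : ℝ}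
variable {σ : β' → ν ≃ ν} {ℓ : ℕ} {xs : β' → ν → ℕ → ν} {γ : β' → ν → ℕ → β} {T : β' → ν → ℕ → Matrix o o ℝ} {m : ℝ}
variable {N : β' → ν → Matrix o o ℝ} {Φ : (ν × o → ℝ) → μ → ℝ} {ϖ d' κ : ℝ}

/-- **`covJensen_polar` — THE POLAR (WILSON-AVERAGE) END** [our proof]: PART 47's letters with `R′` orthogonal and PART 22's loop letter `|(V − 1)w| ≤ κ|w|`
(`0 < κ`), block weights `Σ_x q(y,x) ≤ 1`, and the POLAR CONVENTION LETTER «the block mean of the root-frame defects `Σ_x q(src′e′,x)·N(e′,x)` is SYMMETRIC»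
⟹ `κ₂ = κ²∕2` and `⟨Qu, H_cQu⟩ ≤ (1 + (1 + 2ϖ(1+κ))·κ)·⟨u, H_f u⟩ + 2(1∕2)²(1+κ)κ³·w_c·d′·⟨Qu, Qu⟩`. -/
theorem covJensen_polar
    (hq : ∀ y x, 0 ≤ q y x) (hq1 : ∀ y, ∑ x, q y x ≤ 1) (hW : ∀ y x, (W y x)ᵀ * W y x = 1) (hR : ∀ e, (R e)ᵀ * R e = 1)
    (hR' : ∀ e', (R' e')ᵀ * R' e' = 1)
    (hQ : ∀ (u : ν × o → ℝ) (y : μ), (fun a => (Q *ᵥ u) (y, a)) = ∑ x, q y x • (W y x *ᵥ fun b => u (x, b)))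
    (hwc : 0 ≤ wc)
    (hHc : ∀ v : μ × o → ℝ, v ⬝ᵥ (Hc *ᵥ v) ≤
      wc * ∑ e', ((R' e' *ᵥ fun a => v (tgt' e', a)) - fun a => v (src' e', a)) ⬝ᵥ
        ((R' e' *ᵥ fun a => v (tgt' e', a)) - fun a => v (src' e', a)))
    (hHf : ∀ u : ν × o → ℝ, wf * ∑ e, ((R e *ᵥ fun b => u (tgt e, b)) - fun b => u (src e, b)) ⬝ᵥ
        ((R e *ᵥ fun b => u (tgt e, b)) - fun b => u (src e, b)) ≤ u ⬝ᵥ (Hf *ᵥ u))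
    (hσq : ∀ e' x, q (tgt' e') (σ e' x) = q (src' e') x)
    (hx0 : ∀ e' x, xs e' x 0 = x) (hxℓ : ∀ e' x, xs e' x ℓ = σ e' x)
    (hsrc : ∀ e' x i, i < ℓ → src (γ e' x i) = xs e' x i) (htgt : ∀ e' x i, i < ℓ → tgt (γ e' x i) = xs e' x (i + 1))
    (hT0 : ∀ e' x, T e' x 0 = 1) (hT : ∀ e' x i, i < ℓ → T e' x (i + 1) = T e' x i * R (γ e' x i))
    (hmult : ∀ e, ∑ e', ∑ x, ∑ i ∈ range ℓ, (if γ e' x i = e then q (src' e') x else 0) ≤ m)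
    (hw : wc * ℓ * m ≤ wf)
    (hNdef : ∀ e' x, N e' x = 1 - W (src' e') x * T e' x ℓ * (W (tgt' e') (σ e' x))ᵀ * (R' e')ᵀ)
    (hV : ∀ e' x (w : o → ℝ),
      (((W (src' e') x)ᵀ * R' e' * W (tgt' e') (σ e' x) * (T e' x ℓ)ᵀ - 1) *ᵥ w) ⬝ᵥ
          (((W (src' e') x)ᵀ * R' e' * W (tgt' e') (σ e' x) * (T e' x ℓ)ᵀ - 1) *ᵥ w) ≤ κ ^ 2 * (w ⬝ᵥ w))
    (hsym : ∀ e', (∑ x, q (src' e') x • N e' x)ᵀ = ∑ x, q (src' e') x • N e' x)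
    (u : ν × o → ℝ)
    (hP : ∀ y, ∑ x, q y x * (((W y x *ᵥ fun b => u (x, b)) - fun a => (Q *ᵥ u) (y, a)) ⬝ᵥ
        ((W y x *ᵥ fun b => u (x, b)) - fun a => (Q *ᵥ u) (y, a))) ≤ Φ u y)
    (hΦ : wc * ∑ e', Φ u (tgt' e') ≤ ϖ * (u ⬝ᵥ (Hf *ᵥ u)))
    (hdeg : ∀ y, ((Finset.univ.filter fun e' => tgt' e' = y).card : ℝ) ≤ d')
    (hκ : 0 < κ) (hϖ : 0 ≤ ϖ) (hd' : 0 ≤ d') :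
    (Q *ᵥ u) ⬝ᵥ (Hc *ᵥ (Q *ᵥ u)) ≤
      (1 + (1 + 2 * ϖ * (1 + κ)) * κ) * (u ⬝ᵥ (Hf *ᵥ u)) + 2 * (1 / 2) ^ 2 * (1 + κ) * κ ^ 3 * wc * d' * ((Q *ᵥ u) ⬝ᵥ (Q *ᵥ u)) := by
  -- the root-frame loop transports are orthogonal, and `N = 1 − V̂`
  have hTl : ∀ e' x, (T e' x ℓ)ᵀ * T e' x ℓ = 1 := fun e' x =>
    orthogonal_partialTransport (R := fun i => R (γ e' x i)) (fun i _ => hR _) (hT0 e' x) (fun i hi => hT e' x i hi) ℓ le_rfl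
  have hVo : ∀ e' x, (W (src' e') x * T e' x ℓ * (W (tgt' e') (σ e' x))ᵀ * (R' e')ᵀ)ᵀ *
      (W (src' e') x * T e' x ℓ * (W (tgt' e') (σ e' x))ᵀ * (R' e')ᵀ) = 1 := fun e' x =>
    orthogonal_mul (orthogonal_mul (orthogonal_mul (hW _ _) (hTl e' x)) (transpose_orthogonal (hW _ _))) (transpose_orthogonal (hR' e'))
  have hN : ∀ e' x (w : o → ℝ), (N e' x *ᵥ w) ⬝ᵥ (N e' x *ᵥ w) ≤ κ ^ 2 * (w ⬝ᵥ w) := fun e' x w => by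
    rw [hNdef e' x]
    exact rootDefect_le (hW (src' e') x) (hW (tgt' e') (σ e' x)) (hR' e') (hTl e' x) (hV e' x) w
  have hM : ∀ e' (w : o → ℝ), ((∑ x, q (src' e') x • N e' x) *ᵥ w) ⬝ᵥ ((∑ x, q (src' e') x • N e' x) *ᵥ w) ≤
      (κ ^ 2 / 2) ^ 2 * (w ⬝ᵥ w) := fun e' w => by
    have hs := hsym e'
    simp_rw [hNdef e'] at hs ⊢
    exact wsum_defect_le_of_symm Finset.univ (fun x _ => hq _ x) (hq1 _) (fun x _ => hVo e' x)
      (fun x _ w' => by have h := hN e' x w'; rw [hNdef e' x] at h; exact h) hs w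
  have h := covJensen_consistent hq hq1 hW hR hR' hQ hwc hHc hHf hσq hx0 hxℓ hsrc htgt hT0 hT hmult hw hNdef hN hM u hP hΦ hdeg
    (c := 1 / 2) hκ (by positivity) (le_of_eq (by ring)) hϖ hd'
  exact h

end End

end Summit.QuantumFields.BalabanUV.Beta.GAN24.DerivativeRateTransferJensenMeanZeroPolar

end
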